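import Mathlib.Probability.Martingale.Basic
import Mathlib.Probability.Moments.SubGaussian
import Mathlib.Probability.Distributions.Bernoulli
import Mathlib.MeasureTheory.Integral.MeanInequalities
import Mathlib.Analysis.Convex.SpecificFunctions.Basic
import HarnessLib

/-!
# Predictable-range conditional Hoeffding chain (stub S1 of line `coarse-coin-entropy-chain`)

Crux `stmt-AtomisticToContinuum-13733` (repaired form `ClampedTransferWindowLD`), stub
`stub_predictableHoeffdingChain`: generic, kernel-free probability on an ARBITRARY filtered
measurable space. Marks `T n` (`ℱ (n+1)`-measurable, `|T n| ≤ B`) with PREDICTABLE ranges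
`|T n| ≤ R n` (`R n` is `ℱ n`-measurable) have innovations `D n := T n - μ[T n | ℱ n]` with
`∫⁻ exp (γ/2 · Σ_{n<H} D n) ≤ exp δ` whenever
`∫⁻ exp (Σ_{n<H} min (γ² (R n)²/2) (2|γ| R n)) ≤ exp (2δ)`.

Proof: Hoeffding's lemma for a two-point law (`hoeffding_two_point`, read off Mathlib's
`hasSubgaussianMGF_of_mem_Icc_of_integral_eq_zero` on a `bernoulliMeasure`), the convexity chord
(`mul_exp_le_chord`), one conditional step by the pull-out property `∫ W T = ∫ W μ[T | ℱ n]`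
(`integral_step_le`, no regular conditional probabilities), the supermartingale induction
(`integral_exp_sum_le_one`), truncation of the ranges to `min (R n) B`, Cauchy–Schwarz in `ℝ≥0∞`.
-/

noncomputable section

open MeasureTheory ProbabilityTheory
open scoped ENNReal

namespace Summit.AtomisticToContinuum.HydrodynamicLimit.Theorems.ClampedTransferCoin

namespace HoeffdingChain

/-- **Hoeffding's lemma for a two-point law.** For `a ≤ 0 ≤ b`, `a < b` and real `s`, the mgf of
the mean-zero law on `{a, b}` obeys `(b e^{sa} - a e^{sb}) / (b - a) ≤ exp (s² (b-a)² / 8)`; from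
Mathlib's Hoeffding lemma for the identity on `ℝ` under `bernoulliMeasure b a (-a/(b-a))`.
[folklore] -/
theorem hoeffding_two_point {a b : ℝ} (ha : a ≤ 0) (hb : 0 ≤ b) (hab : a < b) (s : ℝ) :
    (b * Real.exp (s * a) - a * Real.exp (s * b)) / (b - a) ≤
      Real.exp (s ^ 2 * (b - a) ^ 2 / 8) := by
  have hba : 0 < b - a := sub_pos.2 hab
  have hba' : b - a ≠ 0 := hba.ne'
  let p : unitInterval := ⟨-a / (b - a), div_nonneg (neg_nonneg.2 ha) hba.le,
    (div_le_one hba).2 (by linarith)⟩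
  have hp : (p : ℝ) = -a / (b - a) := rfl
  have hX : AEMeasurable (fun x : ℝ => x) (bernoulliMeasure b a p) := aemeasurable_id
  have hIcc : ∀ᵐ x ∂(bernoulliMeasure b a p), (fun x : ℝ => x) x ∈ Set.Icc a b := by
    rw [ae_iff]
    exact bernoulliMeasure_apply_of_notMem_of_notMem p measurableSet_Icc.compl
      (by simp [hab.le]) (by simp [hab.le])
  have hc : ∫ x, (fun x : ℝ => x) x ∂(bernoulliMeasure b a p) = 0 := by
    simp only [integral_bernoulliMeasure, smul_eq_mul, hp]; field_simp; ring
  have h := (hasSubgaussianMGF_of_mem_Icc_of_integral_eq_zero hX hIcc hc).mgf_le s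
  have hmgf : mgf (fun x : ℝ => x) (bernoulliMeasure b a p) s =
      (b * Real.exp (s * a) - a * Real.exp (s * b)) / (b - a) := by
    simp only [mgf, integral_bernoulliMeasure, smul_eq_mul, hp]; field_simp; ring
  rw [hmgf] at h
  refine h.trans (le_of_eq ?_)
  congr 1; push_cast; rw [Real.norm_of_nonneg hba.le]; ring

/-- `γ u ≤ |γ| c` whenever `|u| ≤ c`. [folklore] -/
theorem mul_le_abs_mul {γ u c : ℝ} (hu : |u| ≤ c) : γ * u ≤ |γ| * c :=
  (le_abs_self _).trans (by rw [abs_mul]; exact mul_le_mul_of_nonneg_left hu (abs_nonneg γ))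

/-- **Chord bound (Hoeffding's convexity step), weighted form.** For `|t| ≤ ρ`, `0 ≤ v`:
`v e^{γ (t - x)} ≤ v (e^{γ(ρ-x)} + e^{γ(-ρ-x)})/2 + v (e^{γ(ρ-x)} - e^{γ(-ρ-x)})/(2ρ) · t`
(the graph of `t ↦ e^{γ(t-x)}` on `[-ρ, ρ]` lies below its chord; for `ρ = 0` both sides agree,
with Lean's `x / 0 = 0`). [folklore] -/
theorem mul_exp_le_chord (γ x : ℝ) {v ρ t : ℝ} (hv : 0 ≤ v) (ht : |t| ≤ ρ) :
    v * Real.exp (γ * (t - x)) ≤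
      v * ((Real.exp (γ * (ρ - x)) + Real.exp (γ * (-ρ - x))) / 2) +
        v * ((Real.exp (γ * (ρ - x)) - Real.exp (γ * (-ρ - x))) / (2 * ρ)) * t := by
  have hρ0 : 0 ≤ ρ := (abs_nonneg t).trans ht
  suffices h : Real.exp (γ * (t - x)) ≤
      (Real.exp (γ * (ρ - x)) + Real.exp (γ * (-ρ - x))) / 2 +
        (Real.exp (γ * (ρ - x)) - Real.exp (γ * (-ρ - x))) / (2 * ρ) * t by
    nlinarith [mul_le_mul_of_nonneg_left h hv]
  rcases hρ0.eq_or_lt with rfl | hρ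
  · obtain rfl : t = 0 := abs_nonpos_iff.1 ht
    simp
  · obtain ⟨ht1, ht2⟩ := abs_le.1 ht
    have h2ρ : (0 : ℝ) < 2 * ρ := by positivity
    set p := (ρ - t) / (2 * ρ) with hp
    set q := (ρ + t) / (2 * ρ) with hq
    have hp0 : 0 ≤ p := div_nonneg (by linarith) h2ρ.le
    have hq0 : 0 ≤ q := div_nonneg (by linarith) h2ρ.le
    have hpq : p + q = 1 := by rw [hp, hq, ← add_div]; field_simp; ring
    have key := convexOn_exp.2 (Set.mem_univ (γ * (-ρ - x))) (Set.mem_univ (γ * (ρ - x)))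
      hp0 hq0 hpq
    have hlhs : p • (γ * (-ρ - x)) + q • (γ * (ρ - x)) = γ * (t - x) := by
      simp only [smul_eq_mul, hp, hq]; field_simp; ring
    rw [hlhs] at key
    refine key.trans (le_of_eq ?_)
    simp only [smul_eq_mul, hp, hq]; field_simp; ring

/-- **Hoeffding's lemma at the conditional mean, with the random budget.** For `|x| ≤ ρ`,
`e^{-ψ} · (P + Q x) ≤ 1`, where `P + Q x = ((ρ+x) e^{γ(ρ-x)} + (ρ-x) e^{γ(-ρ-x)}) / (2ρ)` is the
mean of `e^{γ D}` under the mean-zero two-point law on `{-ρ-x, ρ-x}` and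
`ψ = min (γ² ρ² / 2) (2 |γ| ρ)` (sharp constant `(2ρ)²/8 = ρ²/2`, and the crude endpoint bound).
[folklore] -/
theorem exp_neg_budget_mul_le_one (γ : ℝ) {ρ x : ℝ} (hx : |x| ≤ ρ) :
    Real.exp (-min (γ ^ 2 * ρ ^ 2 / 2) (2 * |γ| * ρ)) *
      ((Real.exp (γ * (ρ - x)) + Real.exp (γ * (-ρ - x))) / 2 +
        (Real.exp (γ * (ρ - x)) - Real.exp (γ * (-ρ - x))) / (2 * ρ) * x) ≤ 1 := by
  have hρ0 : 0 ≤ ρ := (abs_nonneg x).trans hx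
  obtain ⟨hx1, hx2⟩ := abs_le.1 hx
  rw [Real.exp_neg, inv_mul_le_iff₀ (Real.exp_pos _), mul_one]
  rcases hρ0.eq_or_lt with rfl | hρ
  · obtain rfl : x = 0 := by linarith
    simp
  have hP : (Real.exp (γ * (ρ - x)) + Real.exp (γ * (-ρ - x))) / 2 +
      (Real.exp (γ * (ρ - x)) - Real.exp (γ * (-ρ - x))) / (2 * ρ) * x =
      ((ρ + x) * Real.exp (γ * (ρ - x)) + (ρ - x) * Real.exp (γ * (-ρ - x))) / (2 * ρ) := by
    field_simp; ring
  rw [hP, Real.exp_monotone.map_min, le_min_iff]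
  constructor
  · have h := hoeffding_two_point (a := -ρ - x) (b := ρ - x) (by linarith) (by linarith)
      (by linarith) γ
    rw [show ρ - x - (-ρ - x) = 2 * ρ by ring] at h
    calc ((ρ + x) * Real.exp (γ * (ρ - x)) + (ρ - x) * Real.exp (γ * (-ρ - x))) / (2 * ρ)
        = ((ρ - x) * Real.exp (γ * (-ρ - x)) - (-ρ - x) * Real.exp (γ * (ρ - x))) / (2 * ρ) := by
          ring
      _ ≤ _ := h
      _ = Real.exp (γ ^ 2 * ρ ^ 2 / 2) := by congr 1; ring
  · have hc : |γ| * (2 * ρ) = 2 * |γ| * ρ := by ring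
    have hep : Real.exp (γ * (ρ - x)) ≤ Real.exp (2 * |γ| * ρ) :=
      hc ▸ Real.exp_le_exp.2 (mul_le_abs_mul (abs_le.2 ⟨by linarith, by linarith⟩))
    have hem : Real.exp (γ * (-ρ - x)) ≤ Real.exp (2 * |γ| * ρ) :=
      hc ▸ Real.exp_le_exp.2 (mul_le_abs_mul (abs_le.2 ⟨by linarith, by linarith⟩))
    rw [div_le_iff₀ (by positivity)]
    nlinarith [mul_le_mul_of_nonneg_left hep (by linarith : (0 : ℝ) ≤ ρ + x),
      mul_le_mul_of_nonneg_left hem (sub_nonneg.2 hx2)]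

/-- The budget `ω ↦ min (γ² ρ² / 2) (2 |γ| ρ)` is measurable when `ρ` is. [folklore] -/
theorem measurable_budget {Ω : Type*} {m : MeasurableSpace Ω} (γ : ℝ) {ρ : Ω → ℝ}
    (hρ : Measurable[m] ρ) :
    Measurable[m] fun ω => min (γ ^ 2 * ρ ω ^ 2 / 2) (2 * |γ| * ρ ω) :=
  (((hρ.pow_const 2).const_mul (γ ^ 2)).div_const 2).min (hρ.const_mul (2 * |γ|))

/-- A conditional expectation inherits a predictable two-sided bound: if `|t| ≤ ρ` with `ρ` an
`m`-measurable bounded function, then `|μ[t | m]| ≤ ρ` a.e. (`condExp_mono` against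
`±ρ = μ[±ρ | m]`). [folklore] -/
theorem ae_abs_condExp_le {Ω : Type*} {m m0 : MeasurableSpace Ω} {μ : Measure Ω}
    [IsFiniteMeasure μ] (hm : m ≤ m0) {t ρ : Ω → ℝ} {K : ℝ} (hρ : StronglyMeasurable[m] ρ)
    (hρK : ∀ ω, ρ ω ≤ K) (ht : Integrable t μ) (htρ : ∀ ω, |t ω| ≤ ρ ω) :
    ∀ᵐ ω ∂μ, |(μ[t|m]) ω| ≤ ρ ω := by
  have hρ0 : ∀ ω, 0 ≤ ρ ω := fun ω => (abs_nonneg _).trans (htρ ω)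
  have hρi : Integrable ρ μ := Integrable.of_bound (hρ.mono hm).aestronglyMeasurable K
    (ae_of_all _ fun ω => by rw [Real.norm_of_nonneg (hρ0 ω)]; exact hρK ω)
  have h1 : μ[t|m] ≤ᵐ[μ] μ[ρ|m] :=
    condExp_mono ht hρi (ae_of_all _ fun ω => (abs_le.1 (htρ ω)).2)
  have h2 : μ[-ρ|m] ≤ᵐ[μ] μ[t|m] :=
    condExp_mono hρi.neg ht (ae_of_all _ fun ω => by simpa using (abs_le.1 (htρ ω)).1)
  rw [condExp_of_stronglyMeasurable hm hρ hρi] at h1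
  rw [condExp_of_stronglyMeasurable hm hρ.neg hρi.neg] at h2
  filter_upwards [h1, h2] with ω h1 h2
  exact abs_le.2 ⟨by simpa using h2, h1⟩

/-- **One predictable-range Hoeffding step (kernel-free).** On a finite measure space with a
sub-σ-algebra `m ≤ m0`, let `V, E, ρ` be `m`-measurable with `0 ≤ V` integrable, `0 ≤ E ≤ 1`,
`ρ ≤ K`, let `t` be measurable with `|t| ≤ ρ`, and suppose `E · (P(ρ,x) + Q(ρ,x) x) ≤ 1` for
`|x| ≤ ρ` (cf. `exp_neg_budget_mul_le_one`). Then `∫ V e^{γ (t - μ[t|m])} E ≤ ∫ V` (with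
integrability): chord bound, `∫ W t = ∫ W μ[t | m]` for the `m`-measurable bounded slope weight
`W` (pull-out property), and the hypothesis at the conditional mean, `|μ[t|m]| ≤ ρ` a.e.
[folklore] -/
theorem integral_step_le {Ω : Type*} {m m0 : MeasurableSpace Ω} {μ : Measure Ω} [IsFiniteMeasure μ]
    (hm : m ≤ m0) (γ : ℝ) {V E ρ t : Ω → ℝ} {K : ℝ}
    (hV : StronglyMeasurable[m] V) (hV0 : ∀ ω, 0 ≤ V ω) (hVi : Integrable V μ)
    (hE : StronglyMeasurable[m] E) (hE0 : ∀ ω, 0 ≤ E ω) (hE1 : ∀ ω, E ω ≤ 1)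
    (hEP : ∀ ω (x : ℝ), |x| ≤ ρ ω →
      E ω * ((Real.exp (γ * (ρ ω - x)) + Real.exp (γ * (-ρ ω - x))) / 2 +
        (Real.exp (γ * (ρ ω - x)) - Real.exp (γ * (-ρ ω - x))) / (2 * ρ ω) * x) ≤ 1)
    (hρ : StronglyMeasurable[m] ρ) (hρK : ∀ ω, ρ ω ≤ K) (ht : StronglyMeasurable t)
    (htρ : ∀ ω, |t ω| ≤ ρ ω) :
    Integrable (fun ω => V ω * (Real.exp (γ * (t ω - (μ[t|m]) ω)) * E ω)) μ ∧
      ∫ ω, V ω * (Real.exp (γ * (t ω - (μ[t|m]) ω)) * E ω) ∂μ ≤ ∫ ω, V ω ∂μ := by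
  have hρ0 : ∀ ω, 0 ≤ ρ ω := fun ω => (abs_nonneg _).trans (htρ ω)
  have htK : ∀ ω, |t ω| ≤ K := fun ω => (htρ ω).trans (hρK ω)
  have hti : Integrable t μ := Integrable.of_bound ht.aestronglyMeasurable K
    (ae_of_all _ fun ω => by rw [Real.norm_eq_abs]; exact htK ω)
  have hcb : ∀ᵐ ω ∂μ, |(μ[t|m]) ω| ≤ ρ ω := ae_abs_condExp_le hm hρ hρK hti htρ
  -- measurability atoms (ambient σ-algebra)
  have hEm : Measurable E := (hE.mono hm).measurable
  have hρm : Measurable ρ := (hρ.mono hm).measurable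
  have hcm : Measurable (μ[t|m]) := (stronglyMeasurable_condExp.mono hm).measurable
  have htm : Measurable t := ht.measurable
  -- `V · Φ` is integrable for every measurable a.e.-bounded `Φ`
  have hVΦ : ∀ {Φ : Ω → ℝ} (C : ℝ), Measurable Φ → (∀ᵐ ω ∂μ, |Φ ω| ≤ C) →
      Integrable (fun ω => V ω * Φ ω) μ := fun C hΦ hb =>
    hVi.mul_bdd hΦ.aestronglyMeasurable (hb.mono fun ω h => by rwa [Real.norm_eq_abs])
  -- exponent bounds on the good set `|μ[t|m]| ≤ ρ`
  have hexp2 : ∀ ω, |(μ[t|m]) ω| ≤ ρ ω →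
      Real.exp (γ * (ρ ω - (μ[t|m]) ω)) ≤ Real.exp (|γ| * (2 * K)) ∧
        Real.exp (γ * (-ρ ω - (μ[t|m]) ω)) ≤ Real.exp (|γ| * (2 * K)) := fun ω hω => by
    obtain ⟨hc1, hc2⟩ := abs_le.1 hω
    exact ⟨Real.exp_le_exp.2 (mul_le_abs_mul (abs_le.2 ⟨by linarith [hρK ω], by linarith [hρK ω]⟩)),
      Real.exp_le_exp.2 (mul_le_abs_mul (abs_le.2
        ⟨by linarith [hρK ω, hρ0 ω], by linarith [hρK ω, hρ0 ω]⟩))⟩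
  -- the slope weight `W` and the constant part `A` of the chord
  obtain ⟨W, hW⟩ : ∃ W : Ω → ℝ, W = fun ω => V ω * E ω *
      ((Real.exp (γ * (ρ ω - (μ[t|m]) ω)) - Real.exp (γ * (-ρ ω - (μ[t|m]) ω))) / (2 * ρ ω)) :=
    ⟨_, rfl⟩
  obtain ⟨A, hA⟩ : ∃ A : Ω → ℝ, A = fun ω => V ω * E ω *
      ((Real.exp (γ * (ρ ω - (μ[t|m]) ω)) + Real.exp (γ * (-ρ ω - (μ[t|m]) ω))) / 2) :=
    ⟨_, rfl⟩
  have hWm : StronglyMeasurable[m] W := by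
    have hρ' : Measurable[m] ρ := hρ.measurable
    have hc' : Measurable[m] (μ[t|m]) := stronglyMeasurable_condExp.measurable
    rw [hW]
    exact ((hV.measurable.mul hE.measurable).mul ((((hρ'.sub hc').const_mul γ).exp.sub
      ((hρ'.neg.sub hc').const_mul γ).exp).div (hρ'.const_mul 2))).stronglyMeasurable
  -- integrability of the products
  have hI : Integrable (fun ω => V ω * (Real.exp (γ * (t ω - (μ[t|m]) ω)) * E ω)) μ := by
    refine hVΦ (Real.exp (|γ| * (2 * K))) (by fun_prop) ?_
    filter_upwards [hcb] with ω hω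
    obtain ⟨hc1, hc2⟩ := abs_le.1 hω
    obtain ⟨ht1, ht2⟩ := abs_le.1 (htK ω)
    rw [abs_mul, Real.abs_exp, abs_of_nonneg (hE0 ω)]
    refine (mul_le_of_le_one_right (Real.exp_pos _).le (hE1 ω)).trans (Real.exp_le_exp.2 ?_)
    exact mul_le_abs_mul (abs_le.2 ⟨by linarith [hρK ω], by linarith [hρK ω]⟩)
  have hAi : Integrable A μ := by
    rw [hA]; simp only [mul_assoc]
    refine hVΦ (Real.exp (|γ| * (2 * K))) (by fun_prop) ?_
    filter_upwards [hcb] with ω hω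
    obtain ⟨hep, hem⟩ := hexp2 ω hω
    rw [abs_mul, abs_of_nonneg (hE0 ω), abs_of_pos (by positivity)]
    refine (mul_le_of_le_one_left (by positivity) (hE1 ω)).trans ?_
    linarith
  have hWu : ∀ u : Ω → ℝ, Measurable u → (∀ᵐ ω ∂μ, |u ω| ≤ ρ ω) →
      Integrable (fun ω => W ω * u ω) μ := by
    intro u hu hub
    rw [hW]; simp only [mul_assoc]
    refine hVΦ (Real.exp (|γ| * (2 * K))) (by fun_prop) ?_
    filter_upwards [hcb, hub] with ω hω hω'
    obtain ⟨hep, hem⟩ := hexp2 ω hω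
    rw [abs_mul, abs_of_nonneg (hE0 ω)]
    refine (mul_le_of_le_one_left (abs_nonneg _) (hE1 ω)).trans ?_
    rcases (hρ0 ω).eq_or_lt with h0 | hpos
    · rw [← h0]; simp [Real.exp_nonneg]
    rw [abs_mul, abs_div, abs_of_pos (by positivity : (0 : ℝ) < 2 * ρ ω), div_mul_eq_mul_div,
      div_le_iff₀ (by positivity : (0 : ℝ) < 2 * ρ ω)]
    have hd : |Real.exp (γ * (ρ ω - (μ[t|m]) ω)) - Real.exp (γ * (-ρ ω - (μ[t|m]) ω))| ≤
        Real.exp (γ * (ρ ω - (μ[t|m]) ω)) + Real.exp (γ * (-ρ ω - (μ[t|m]) ω)) :=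
      abs_sub_le_iff.2 ⟨by linarith [Real.exp_pos (γ * (-ρ ω - (μ[t|m]) ω))],
        by linarith [Real.exp_pos (γ * (ρ ω - (μ[t|m]) ω))]⟩
    nlinarith [mul_le_mul hd hω' (abs_nonneg _) (by positivity), hρ0 ω]
  have hWt : Integrable (fun ω => W ω * t ω) μ := hWu t htm (ae_of_all _ htρ)
  have hWc : Integrable (fun ω => W ω * (μ[t|m]) ω) μ := hWu _ hcm hcb
  -- pull-out: `∫ W t = ∫ W μ[t | m]`
  have hWtc : ∫ ω, W ω * t ω ∂μ = ∫ ω, W ω * (μ[t|m]) ω ∂μ := by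
    have hpull := condExp_mul_of_stronglyMeasurable_left hWm hWt hti
    calc ∫ ω, W ω * t ω ∂μ = ∫ ω, (μ[W * t|m]) ω ∂μ := (integral_condExp hm).symm
      _ = ∫ ω, W ω * (μ[t|m]) ω ∂μ :=
          integral_congr_ae (hpull.mono fun ω h => by simpa using h)
  -- the chord bound, pointwise, and the hypothesis at the conditional mean, a.e.
  have hpt : ∀ ω, V ω * (Real.exp (γ * (t ω - (μ[t|m]) ω)) * E ω) ≤ A ω + W ω * t ω := by
    intro ω
    rw [hA, hW]
    have h := mul_exp_le_chord γ ((μ[t|m]) ω) (mul_nonneg (hV0 ω) (hE0 ω)) (htρ ω)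
    calc V ω * (Real.exp (γ * (t ω - (μ[t|m]) ω)) * E ω)
        = V ω * E ω * Real.exp (γ * (t ω - (μ[t|m]) ω)) := by ring
      _ ≤ _ := h
  have hae : ∀ᵐ ω ∂μ, A ω + W ω * (μ[t|m]) ω ≤ V ω := by
    filter_upwards [hcb] with ω hω
    rw [hA, hW]
    nlinarith [mul_le_mul_of_nonneg_left (hEP ω ((μ[t|m]) ω) hω) (hV0 ω)]
  refine ⟨hI, ?_⟩
  calc ∫ ω, V ω * (Real.exp (γ * (t ω - (μ[t|m]) ω)) * E ω) ∂μ
      ≤ ∫ ω, (A ω + W ω * t ω) ∂μ :=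
        integral_mono_of_nonneg (ae_of_all _ fun ω =>
          mul_nonneg (hV0 ω) (mul_nonneg (Real.exp_pos _).le (hE0 ω))) (hAi.add hWt)
          (ae_of_all _ hpt)
    _ = ∫ ω, A ω ∂μ + ∫ ω, W ω * (μ[t|m]) ω ∂μ := by rw [integral_add hAi hWt, hWtc]
    _ = ∫ ω, (A ω + W ω * (μ[t|m]) ω) ∂μ := (integral_add hAi hWc).symm
    _ ≤ ∫ ω, V ω ∂μ := integral_mono_ae (hAi.add hWc) hVi hae

/-- **Supermartingale induction.** If every `f n` is `ℱ (n+1)`-measurable and for every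
`ℱ n`-measurable weight `V ≥ 0` with `V` integrable one has `∫ V e^{f n} ≤ ∫ V` (with
integrability), then `∫ exp (Σ_{k<n} f k) ≤ 1` on a probability space. [folklore] -/
theorem integral_exp_sum_le_one {Ω : Type*} {m0 : MeasurableSpace Ω} (μ : Measure Ω)
    [IsProbabilityMeasure μ] (ℱ : Filtration ℕ m0) (f : ℕ → Ω → ℝ)
    (hf : ∀ n, StronglyMeasurable[ℱ (n + 1)] (f n))
    (hstep : ∀ n (V : Ω → ℝ), StronglyMeasurable[ℱ n] V → (∀ ω, 0 ≤ V ω) → Integrable V μ →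
      Integrable (fun ω => V ω * Real.exp (f n ω)) μ ∧
        ∫ ω, V ω * Real.exp (f n ω) ∂μ ≤ ∫ ω, V ω ∂μ) (n : ℕ) :
    Integrable (fun ω => Real.exp (∑ k ∈ Finset.range n, f k ω)) μ ∧
      ∫ ω, Real.exp (∑ k ∈ Finset.range n, f k ω) ∂μ ≤ 1 := by
  induction n with
  | zero => exact ⟨by simp, by simp⟩
  | succ n ih =>
    have hV : StronglyMeasurable[ℱ n] fun ω => Real.exp (∑ k ∈ Finset.range n, f k ω) := by
      refine (Finset.measurable_sum _ fun k hk => ?_).exp.stronglyMeasurable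
      exact ((hf k).mono (ℱ.mono (Nat.succ_le_of_lt (Finset.mem_range.1 hk)))).measurable
    obtain ⟨h1, h2⟩ := hstep n _ hV (fun ω => (Real.exp_pos _).le) ih.1
    simp_rw [Finset.sum_range_succ, Real.exp_add]
    exact ⟨h1, h2.trans ih.2⟩

end HoeffdingChain

open HoeffdingChain in
/-- **S1 · predictable-range conditional Hoeffding chain (entropy chain rule in exponential-moment
form).** Along a filtration `ℱ` of an arbitrary measurable space carrying a probability measure
`μ`, let the marks `T n` be `ℱ (n+1)`-measurable with `|T n| ≤ B` and predictable ranges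
`|T n| ≤ R n` (`R n` is `ℱ n`-measurable, possibly unbounded). Then the innovations
`T n - μ[T n | ℱ n]` satisfy `∫⁻ exp (γ/2 · Σ_{n<H} (T n - μ[T n | ℱ n])) dμ ≤ exp δ` as soon as the
random budget obeys `∫⁻ exp (Σ_{n<H} min (γ² (R n)²/2) (2|γ| R n)) dμ ≤ exp (2δ)`. Proof: truncate
the ranges to `min (R n) B`, run the kernel-free supermartingale `∫ exp (Σ (γ D n - ψ n)) ≤ 1`
(`HoeffdingChain.integral_step_le`, `HoeffdingChain.integral_exp_sum_le_one`), and finish by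
Cauchy–Schwarz in `ℝ≥0∞`. [folklore] -/
theorem stub_predictableHoeffdingChain {Ω : Type*} {m0 : MeasurableSpace Ω} (μ : Measure Ω)
    [IsProbabilityMeasure μ] (ℱ : Filtration ℕ m0) (T R : ℕ → Ω → ℝ) (B : ℝ)
    (hT : ∀ n, StronglyMeasurable[ℱ (n + 1)] (T n)) (hR : ∀ n, StronglyMeasurable[ℱ n] (R n))
    (hB : ∀ n ω, |T n ω| ≤ B) (hTR : ∀ n ω, |T n ω| ≤ R n ω) (H : ℕ) (γ δ : ℝ)
    (hbudget : ∫⁻ ω, ENNReal.ofReal (Real.exp (∑ n ∈ Finset.range H,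
      min (γ ^ 2 * R n ω ^ 2 / 2) (2 * |γ| * R n ω))) ∂μ ≤ ENNReal.ofReal (Real.exp (2 * δ))) :
    ∫⁻ ω, ENNReal.ofReal (Real.exp (γ / 2 * ∑ n ∈ Finset.range H, (T n ω - (μ[T n|ℱ n]) ω))) ∂μ ≤
      ENNReal.ofReal (Real.exp δ) := by
  -- Step 0: truncated predictable ranges `min (R n) B`, bounded by `B`
  have hR'm : ∀ n, StronglyMeasurable[ℱ n] fun ω => min (R n ω) B := fun n =>
    ((hR n).measurable.min measurable_const).stronglyMeasurable
  have hTR' : ∀ n ω, |T n ω| ≤ min (R n ω) B := fun n ω => le_min (hTR n ω) (hB n ω)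
  have hR'B : ∀ n ω, min (R n ω) B ≤ B := fun n ω => min_le_right _ _
  have hR'0 : ∀ n ω, 0 ≤ min (R n ω) B := fun n ω => (abs_nonneg _).trans (hTR' n ω)
  -- Steps 1-2: the supermartingale `∫ exp (Σ_{k<H} (γ D k - ψ k)) ≤ 1`
  have e3 : ∀ a b : ℝ, Real.exp (a - b) = Real.exp a * Real.exp (-b) := fun a b => by
    rw [sub_eq_add_neg, Real.exp_add]
  have hf : ∀ n, StronglyMeasurable[ℱ (n + 1)] fun ω => γ * (T n ω - (μ[T n|ℱ n]) ω) -
      min (γ ^ 2 * min (R n ω) B ^ 2 / 2) (2 * |γ| * min (R n ω) B) := fun n =>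
    ((((hT n).measurable.sub (stronglyMeasurable_condExp.mono (ℱ.mono n.le_succ)).measurable
      ).const_mul γ).sub (measurable_budget γ ((hR'm n).mono (ℱ.mono n.le_succ)).measurable)
      ).stronglyMeasurable
  obtain ⟨hint, hle⟩ := integral_exp_sum_le_one μ ℱ _ hf (fun n V hV hV0 hVi => by
    simpa only [e3] using integral_step_le (ℱ.le n) γ hV hV0 hVi
      (E := fun ω => Real.exp (-min (γ ^ 2 * min (R n ω) B ^ 2 / 2) (2 * |γ| * min (R n ω) B)))
      (measurable_budget γ (hR'm n).measurable).neg.exp.stronglyMeasurable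
      (fun ω => (Real.exp_pos _).le)
      (fun ω => Real.exp_le_one_iff.2 (neg_nonpos.2
        (le_min (by positivity) (mul_nonneg (by positivity) (hR'0 n ω)))))
      (fun ω x hx => exp_neg_budget_mul_le_one γ hx)
      (hR'm n) (hR'B n) ((hT n).mono (ℱ.le _)) (hTR' n)) H
  -- Step 3: Cauchy-Schwarz in `ℝ≥0∞`
  obtain ⟨Y, hY⟩ : ∃ Y : Ω → ℝ, Y = fun ω => ∑ k ∈ Finset.range H,
      (γ * (T k ω - (μ[T k|ℱ k]) ω) -
        min (γ ^ 2 * min (R k ω) B ^ 2 / 2) (2 * |γ| * min (R k ω) B)) := ⟨_, rfl⟩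
  obtain ⟨Ψ, hΨ⟩ : ∃ Ψ : Ω → ℝ, Ψ = fun ω => ∑ k ∈ Finset.range H,
      min (γ ^ 2 * min (R k ω) B ^ 2 / 2) (2 * |γ| * min (R k ω) B) := ⟨_, rfl⟩
  have hint' : Integrable (fun ω => Real.exp (Y ω)) μ := by rw [hY]; exact hint
  have hle' : ∫ ω, Real.exp (Y ω) ∂μ ≤ 1 := by rw [hY]; exact hle
  have hYm : Measurable Y := by
    rw [hY]; exact Finset.measurable_sum _ fun k _ => ((hf k).mono (ℱ.le _)).measurable
  have hΨm : Measurable Ψ := by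
    rw [hΨ]
    exact Finset.measurable_sum _ fun k _ => measurable_budget γ ((hR'm k).mono (ℱ.le k)).measurable
  have hsq : ∀ u : ℝ, ENNReal.ofReal (Real.exp (u / 2)) ^ (2 : ℝ) = ENNReal.ofReal (Real.exp u) :=
    fun u => by
      rw [ENNReal.ofReal_rpow_of_nonneg (Real.exp_pos _).le zero_le_two, ← Real.exp_mul,
        div_mul_cancel₀ u two_ne_zero]
  have h1 : ∫⁻ ω, ENNReal.ofReal (Real.exp (Y ω / 2)) ^ (2 : ℝ) ∂μ ≤ 1 := by
    simp_rw [hsq]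
    rw [← ofReal_integral_eq_lintegral_ofReal hint' (ae_of_all _ fun ω => (Real.exp_pos _).le)]
    exact ENNReal.ofReal_le_one.2 hle'
  have h2 : ∫⁻ ω, ENNReal.ofReal (Real.exp (Ψ ω / 2)) ^ (2 : ℝ) ∂μ ≤
      ENNReal.ofReal (Real.exp (2 * δ)) := by
    simp_rw [hsq]
    refine (lintegral_mono fun ω => ENNReal.ofReal_le_ofReal (Real.exp_le_exp.2 ?_)).trans hbudget
    rw [hΨ]
    exact Finset.sum_le_sum fun k _ => min_le_min
      (div_le_div_of_nonneg_right (mul_le_mul_of_nonneg_left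
        (pow_le_pow_left₀ (hR'0 k ω) (min_le_left _ _) 2) (sq_nonneg γ)) zero_le_two)
      (mul_le_mul_of_nonneg_left (min_le_left _ _) (by positivity))
  have hFG : ∀ ω, ENNReal.ofReal (Real.exp (γ / 2 * ∑ n ∈ Finset.range H, (T n ω - (μ[T n|ℱ n]) ω)))
      = ENNReal.ofReal (Real.exp (Y ω / 2)) * ENNReal.ofReal (Real.exp (Ψ ω / 2)) := by
    intro ω
    rw [← ENNReal.ofReal_mul (Real.exp_pos _).le, ← Real.exp_add, hY, hΨ]
    congr 2
    simp only [Finset.sum_sub_distrib, ← Finset.mul_sum]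
    ring
  calc ∫⁻ ω, ENNReal.ofReal (Real.exp (γ / 2 * ∑ n ∈ Finset.range H, (T n ω - (μ[T n|ℱ n]) ω))) ∂μ
      = ∫⁻ ω, ((fun ω => ENNReal.ofReal (Real.exp (Y ω / 2))) *
          fun ω => ENNReal.ofReal (Real.exp (Ψ ω / 2))) ω ∂μ := lintegral_congr fun ω => hFG ω
    _ ≤ (∫⁻ ω, ENNReal.ofReal (Real.exp (Y ω / 2)) ^ (2 : ℝ) ∂μ) ^ (1 / (2 : ℝ)) *
          (∫⁻ ω, ENNReal.ofReal (Real.exp (Ψ ω / 2)) ^ (2 : ℝ) ∂μ) ^ (1 / (2 : ℝ)) :=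
        ENNReal.lintegral_mul_le_Lp_mul_Lq μ Real.HolderConjugate.two_two
          (hYm.div_const 2).exp.ennreal_ofReal.aemeasurable
          (hΨm.div_const 2).exp.ennreal_ofReal.aemeasurable
    _ ≤ (1 : ℝ≥0∞) ^ (1 / (2 : ℝ)) * ENNReal.ofReal (Real.exp (2 * δ)) ^ (1 / (2 : ℝ)) :=
        mul_le_mul' (ENNReal.rpow_le_rpow h1 (by norm_num)) (ENNReal.rpow_le_rpow h2 (by norm_num))
    _ = ENNReal.ofReal (Real.exp δ) := by
        rw [ENNReal.one_rpow, one_mul, ENNReal.ofReal_rpow_of_nonneg (Real.exp_pos _).le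
          (by norm_num), ← Real.exp_mul]
        congr 2
        ring

end Summit.AtomisticToContinuum.HydrodynamicLimit.Theorems.ClampedTransferCoin

end
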